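import Summits.CriticalPhenomena.PercolationContinuityZ3.Theorems.PercNearOneGluingNoHeavyQuantFarTreeTriple
import Summits.CriticalPhenomena.PercolationContinuityZ3.Theorems.PercNearOneGluingNoHeavyQuantTreeClusterTransfer
import HarnessLib

/-!
# QUANT lane R8: layer one of FAR on every tree with two reliable companions — in particular MAJORITY(3) on trees

builds on p205010 (kernel theorem, internal audit signed; external expert review pending)

Support file (`--supports stmt-CriticalPhenomena-4575`), QUANT lane lead (gen 7), rung R8 of
`run/shared/lean/prim/quant/LADDER.md`; memo `prim-quant-lead-g7/LEAD-NOTES-G7.md` N15.  Companion of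
`…QuantFarTreeTriple.lean` (the three-witness inequality for laminar chains) and of the tree transfer
`…QuantTreeClusterTransfer.lean` (p219638).  Theorems only; no definitions, no sorries, standard axioms.

**Trees in coordinates** (as in `Quant.tree_cluster_transfer`): root `o`, `par : Fin n → Fin n`, `depth : Fin n → ℕ` with
`par x ≠ o ∧ depth (par x) + 1 = depth x` whenever `x ≠ o`, `depth x ≠ 0` (and `par x = o` at depth `0`); the ancestral chain of
`x ≠ o` is the finset `(range (depth x + 1)).image (fun i => par^[i] x)` (written `anc x` below; `x` itself included, `o` excluded).

* `Quant.tree_anc_subset`, `Quant.tree_anc_chain`, `Quant.tree_anc_inter_nested` — chains: an ancestor's chain is an initial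
  segment; two members of a chain are comparable; the traces `anc a ∩ anc b`, `anc a ∩ anc c` on one chain are nested.
* `Quant.tree_anc_laminar` — **ancestral chains of three vertices are laminar**:
  `(anc a ∩ anc b = anc a ∩ anc c) ∨ (anc a ∩ anc b ⊆ anc a ∩ anc c ∧ anc b ∩ anc c ⊆ anc a) ∨ (sym.)` — the hypothesis of
  `Quant.triple_prod_ineq`.
* `Quant.tree_gate_card_le_one_le` — gate coordinates: for `prodBernoulli q` on the vertices and a relay set `R` containing three
  vertices `a, b, c ≠ o` with `π(anc a) ≤ π(anc b)`, `π(anc a) ≤ π(anc c)`, `1 ≤ π(anc b) + π(anc c)`: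
  `P(#{x ∈ R | x = o ∨ anc x open} ≤ 1) ≤ 1 − π(anc a)`.
* `Quant.farRelayRow_tree_layerOne_of_companions` — **route vocabulary** (tree-supported `w` on the pairs of `Fin n`, events `openConn`):
  if `a, b, c ∈ A` are distinct non-root vertices with `P(o ↔ a) ≤ P(o ↔ b)`, `P(o ↔ a) ≤ P(o ↔ c)` and `P(o ↔ b) + P(o ↔ c) ≥ 1`, then
  `P(#{x ∈ A | o ↔ x} ≤ 1) ≤ P(o ↮ a)`.  No hypothesis on the mean.
* `Quant.farRelayRow_tree_layerOne_half` — **the `j = 1` instance of `Quant.FarRelayRow` on every tree in the regime `t ≤ 1/2`**: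
  `2 < Σ_{a∈A} P(o ↔ a)`, `P(o ↮ a) ≤ t ≤ 1/2` for all `a ∈ A` ⟹ `P(#{a ∈ A | o ↔ a} ≤ 1) ≤ t` (= MAJORITY(3) on trees with the FAR
  normalisation; MAJORITY's layer 1 is FALSE on general graphs from five vertices, `Quant.majorityRow_false_layerOne`, and its layers
  `j ≥ 2` are false already on trees, `Quant.majorityRow_false`).  The complementary regime `t > 1/2` of layer 1 on trees stays open
  (exact search, lead g7: ratio ≤ 0.61 after the reductions of LEAD-NOTES-G7 N15; no violation).
Paper proofs of MAJORITY(3) on trees by Steiner shapes: prim-quant-p1 g4 (P1-SURPLUS §14.3), prim-quant-stmt g8 (LAYER1-TREES.md).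
[cite: KozmaNitzan2024, Lemma 2 (p. 6), Conjecture 3 (p. 15)] (context); [cite: Grimmett1999, §1.3 p. 10; §10.1 (trees)] (independent
gates on a tree); the theorems [this work].
-/

noncomputable section

namespace Summit.CriticalPhenomena.PercolationContinuityZ3.Theorems

namespace Quant

open Finset MeasureTheory
open Literature.Probability.LatticeModels
open Literature.Probability.Percolation
open scoped Classical

variable {ι : Type*} {n : ℕ}

/-! ### Ancestral chains (any vertex type; the classical `DecidableEq`, as in the companion file) -/

/-- Generic form of `Quant.tree_iterate_par`: the ancestors `par^[i] x` (`i ≤ depth x`) of `x ≠ o` are not the root and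
`depth (par^[i] x) + i = depth x`. [this work] -/
theorem chain_iterate_par (o : ι) (depth : ι → ℕ) (par : ι → ι)
    (hstep : ∀ x, x ≠ o → depth x ≠ 0 → par x ≠ o ∧ depth (par x) + 1 = depth x)
    (x : ι) (hx : x ≠ o) : ∀ i, i ≤ depth x → par^[i] x ≠ o ∧ depth (par^[i] x) + i = depth x := by
  intro i
  induction i with
  | zero => intro _; exact ⟨hx, by simp⟩
  | succ i ih =>
    intro hi
    obtain ⟨h1, h2⟩ := ih (by omega)
    have hd : depth (par^[i] x) ≠ 0 := by omega
    obtain ⟨h3, h4⟩ := hstep _ h1 hd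
    refine ⟨by rw [Function.iterate_succ_apply']; exact h3, ?_⟩
    rw [Function.iterate_succ_apply']
    omega

/-- Membership in the ancestral chain. [this work] -/
theorem tree_mem_anc (depth : ι → ℕ) (par : ι → ι) (x u : ι) :
    u ∈ (Finset.range (depth x + 1)).image (fun i => par^[i] x) ↔ ∃ i, i ≤ depth x ∧ par^[i] x = u := by
  simp only [Finset.mem_image, Finset.mem_range, Nat.lt_succ_iff]

/-- A vertex belongs to its own chain. [this work] -/
theorem tree_self_mem_anc (depth : ι → ℕ) (par : ι → ι) (x : ι) :
    x ∈ (Finset.range (depth x + 1)).image (fun i => par^[i] x) :=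
  (tree_mem_anc depth par x x).2 ⟨0, Nat.zero_le _, rfl⟩

/-- **An ancestor's chain is contained in the chain.** [this work] -/
theorem tree_anc_subset (o : ι) (depth : ι → ℕ) (par : ι → ι)
    (hstep : ∀ x, x ≠ o → depth x ≠ 0 → par x ≠ o ∧ depth (par x) + 1 = depth x)
    {x u : ι} (hx : x ≠ o) (hu : u ∈ (Finset.range (depth x + 1)).image (fun i => par^[i] x)) :
    (Finset.range (depth u + 1)).image (fun i => par^[i] u) ⊆ (Finset.range (depth x + 1)).image (fun i => par^[i] x) := by
  obtain ⟨i, hi, rfl⟩ := (tree_mem_anc depth par x u).1 hu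
  have hdi := (chain_iterate_par o depth par hstep x hx i hi).2
  intro w hw
  obtain ⟨j, hj, rfl⟩ := (tree_mem_anc depth par _ w).1 hw
  refine (tree_mem_anc depth par x _).2 ⟨j + i, by omega, ?_⟩
  rw [Function.iterate_add_apply]

/-- **Two members of a chain are comparable**: the shallower one is an ancestor of the deeper one. [this work] -/
theorem tree_anc_chain (o : ι) (depth : ι → ℕ) (par : ι → ι)
    (hstep : ∀ x, x ≠ o → depth x ≠ 0 → par x ≠ o ∧ depth (par x) + 1 = depth x)
    {x u v : ι} (hx : x ≠ o) (hu : u ∈ (Finset.range (depth x + 1)).image (fun i => par^[i] x))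
    (hv : v ∈ (Finset.range (depth x + 1)).image (fun i => par^[i] x)) (hduv : depth u ≤ depth v) :
    u ∈ (Finset.range (depth v + 1)).image (fun i => par^[i] v) := by
  obtain ⟨i, hi, rfl⟩ := (tree_mem_anc depth par x u).1 hu
  obtain ⟨i', hi', rfl⟩ := (tree_mem_anc depth par x v).1 hv
  have hdi := (chain_iterate_par o depth par hstep x hx i hi).2
  have hdi' := (chain_iterate_par o depth par hstep x hx i' hi').2
  refine (tree_mem_anc depth par _ _).2 ⟨i - i', by omega, ?_⟩
  rw [← Function.iterate_add_apply]
  congr 1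
  omega

/-- The traces of two chains on a third chain are nested. [this work] -/
theorem tree_anc_inter_nested (o : ι) (depth : ι → ℕ) (par : ι → ι)
    (hstep : ∀ x, x ≠ o → depth x ≠ 0 → par x ≠ o ∧ depth (par x) + 1 = depth x)
    {a b c : ι} (ha : a ≠ o) (hb : b ≠ o) (hc : c ≠ o) :
    (Finset.range (depth a + 1)).image (fun i => par^[i] a) ∩ (Finset.range (depth b + 1)).image (fun i => par^[i] b) ⊆
        (Finset.range (depth a + 1)).image (fun i => par^[i] a) ∩ (Finset.range (depth c + 1)).image (fun i => par^[i] c) ∨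
      (Finset.range (depth a + 1)).image (fun i => par^[i] a) ∩ (Finset.range (depth c + 1)).image (fun i => par^[i] c) ⊆
        (Finset.range (depth a + 1)).image (fun i => par^[i] a) ∩ (Finset.range (depth b + 1)).image (fun i => par^[i] b) := by
  set A := (Finset.range (depth a + 1)).image (fun i => par^[i] a) with hA
  set B := (Finset.range (depth b + 1)).image (fun i => par^[i] b) with hB
  set C := (Finset.range (depth c + 1)).image (fun i => par^[i] c) with hC
  by_cases h : A ∩ B ⊆ A ∩ C
  · exact Or.inl h
  · right
    obtain ⟨u, huS, huT⟩ := Finset.not_subset.1 h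
    rw [Finset.mem_inter] at huS
    intro v hv
    rw [Finset.mem_inter] at hv ⊢
    refine ⟨hv.1, ?_⟩
    rcases le_or_gt (depth u) (depth v) with hle | hlt
    · -- `u` is an ancestor of `v ∈ anc c`, so `u ∈ anc c`: contradiction
      exact absurd (Finset.mem_inter.2 ⟨huS.1, tree_anc_subset o depth par hstep hc hv.2
        (tree_anc_chain o depth par hstep ha huS.1 hv.1 hle)⟩) huT
    · -- `v` is an ancestor of `u ∈ anc b`
      exact tree_anc_subset o depth par hstep hb huS.2 (tree_anc_chain o depth par hstep ha hv.1 huS.1 hlt.le)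

/-- **Ancestral chains of three vertices are laminar** (the hypothesis of `Quant.triple_prod_ineq`). [this work] -/
theorem tree_anc_laminar (o : ι) (depth : ι → ℕ) (par : ι → ι)
    (hstep : ∀ x, x ≠ o → depth x ≠ 0 → par x ≠ o ∧ depth (par x) + 1 = depth x)
    {a b c : ι} (ha : a ≠ o) (hb : b ≠ o) (hc : c ≠ o) :
    ((Finset.range (depth a + 1)).image (fun i => par^[i] a) ∩ (Finset.range (depth b + 1)).image (fun i => par^[i] b) =
        (Finset.range (depth a + 1)).image (fun i => par^[i] a) ∩ (Finset.range (depth c + 1)).image (fun i => par^[i] c)) ∨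
      ((Finset.range (depth a + 1)).image (fun i => par^[i] a) ∩ (Finset.range (depth b + 1)).image (fun i => par^[i] b) ⊆
          (Finset.range (depth a + 1)).image (fun i => par^[i] a) ∩ (Finset.range (depth c + 1)).image (fun i => par^[i] c) ∧
        (Finset.range (depth b + 1)).image (fun i => par^[i] b) ∩ (Finset.range (depth c + 1)).image (fun i => par^[i] c) ⊆
          (Finset.range (depth a + 1)).image (fun i => par^[i] a)) ∨
      ((Finset.range (depth a + 1)).image (fun i => par^[i] a) ∩ (Finset.range (depth c + 1)).image (fun i => par^[i] c) ⊆
          (Finset.range (depth a + 1)).image (fun i => par^[i] a) ∩ (Finset.range (depth b + 1)).image (fun i => par^[i] b) ∧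
        (Finset.range (depth b + 1)).image (fun i => par^[i] b) ∩ (Finset.range (depth c + 1)).image (fun i => par^[i] c) ⊆
          (Finset.range (depth a + 1)).image (fun i => par^[i] a)) := by
  set A := (Finset.range (depth a + 1)).image (fun i => par^[i] a) with hA
  set B := (Finset.range (depth b + 1)).image (fun i => par^[i] b) with hB
  set C := (Finset.range (depth c + 1)).image (fun i => par^[i] c) with hC
  by_cases heq : A ∩ B = A ∩ C
  · exact Or.inl heq
  -- the key step, symmetric in `b`, `c`: a strict inclusion of traces forces `B ∩ C ⊆ A`
  have key : ∀ {b c : ι}, b ≠ o → c ≠ o →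
      ¬ (A ∩ (Finset.range (depth c + 1)).image (fun i => par^[i] c) ⊆
          A ∩ (Finset.range (depth b + 1)).image (fun i => par^[i] b)) →
      (Finset.range (depth b + 1)).image (fun i => par^[i] b) ∩ (Finset.range (depth c + 1)).image (fun i => par^[i] c) ⊆ A := by
    intro b c hb hc hnot
    obtain ⟨u, huT, huS⟩ := Finset.not_subset.1 hnot
    rw [Finset.mem_inter] at huT
    have hub : u ∉ (Finset.range (depth b + 1)).image (fun i => par^[i] b) := fun h => huS (Finset.mem_inter.2 ⟨huT.1, h⟩)
    intro v hv
    rw [Finset.mem_inter] at hv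
    rcases le_or_gt (depth v) (depth u) with hle | hlt
    · -- `v` is an ancestor of `u ∈ anc a`
      exact tree_anc_subset o depth par hstep ha huT.1 (tree_anc_chain o depth par hstep hc hv.2 huT.2 hle)
    · -- `u` is an ancestor of `v ∈ anc b`: contradiction
      exact absurd (tree_anc_subset o depth par hstep hb hv.1 (tree_anc_chain o depth par hstep hc huT.2 hv.2 hlt.le)) hub
  rcases tree_anc_inter_nested o depth par hstep ha hb hc with h1 | h2
  · -- `A ∩ B ⊊ A ∩ C`
    right; left
    refine ⟨h1, key hb hc fun h' => heq (Finset.Subset.antisymm h1 h')⟩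
  · right; right
    refine ⟨h2, ?_⟩
    rw [Finset.inter_comm]
    exact key hc hb fun h' => heq (Finset.Subset.antisymm h' h2)

/-! ### Gate coordinates -/

/-- **Layer one on a tree, gate coordinates.**  Vertex gates `prodBernoulli q`; a vertex `x` is reached iff `x = o` or its whole
ancestral chain is open.  If the relay set `R` contains three distinct non-root vertices `a, b, c` with
`π(anc a) ≤ π(anc b)`, `π(anc a) ≤ π(anc c)` and `1 ≤ π(anc b) + π(anc c)` (`π` = product of the gates), then
`P(#{x ∈ R | x reached} ≤ 1) ≤ 1 − π(anc a)`. [this work] -/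
theorem tree_gate_card_le_one_le (o : ι) (depth : ι → ℕ) (par : ι → ι)
    (hstep : ∀ x, x ≠ o → depth x ≠ 0 → par x ≠ o ∧ depth (par x) + 1 = depth x)
    [Finite ι] (q : ι → unitInterval) (R : Finset ι) {a b c : ι} (haR : a ∈ R) (hbR : b ∈ R) (hcR : c ∈ R)
    (hao : a ≠ o) (hbo : b ≠ o) (hco : c ≠ o) (hab : a ≠ b) (hac : a ≠ c) (hbc : b ≠ c)
    (hAB : ∏ i ∈ (Finset.range (depth a + 1)).image (fun i => par^[i] a), (q i : ℝ) ≤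
      ∏ i ∈ (Finset.range (depth b + 1)).image (fun i => par^[i] b), (q i : ℝ))
    (hAC : ∏ i ∈ (Finset.range (depth a + 1)).image (fun i => par^[i] a), (q i : ℝ) ≤
      ∏ i ∈ (Finset.range (depth c + 1)).image (fun i => par^[i] c), (q i : ℝ))
    (hsum : 1 ≤ (∏ i ∈ (Finset.range (depth b + 1)).image (fun i => par^[i] b), (q i : ℝ)) +
      ∏ i ∈ (Finset.range (depth c + 1)).image (fun i => par^[i] c), (q i : ℝ)) :
    (prodBernoulli q).real {ω' : Set ι | (R.filter fun x => x = o ∨ ∀ i, i ≤ depth x → par^[i] x ∈ ω').card ≤ 1} ≤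
      1 - ∏ i ∈ (Finset.range (depth a + 1)).image (fun i => par^[i] a), (q i : ℝ) := by
  set T : ι → Finset ι := fun x => (Finset.range (depth x + 1)).image (fun i => par^[i] x) with hT
  have hlam := tree_anc_laminar o depth par hstep hao hbo hco
  -- (the laminarity statement of the companion file carries the classical `DecidableEq`; `convert` bridges the instances)
  have h1 := prodBernoulli_card_le_one_le q T R haR hbR hcR hab hac hbc hlam hAB hAC hsum
  -- `anc x open` implies `x reached`, so the filter only grows and the event only shrinks
  have hsub : {ω' : Set ι | (R.filter fun x => x = o ∨ ∀ i, i ≤ depth x → par^[i] x ∈ ω').card ≤ 1} ⊆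
      {ω' : Set ι | (R.filter fun x => ((T x : Finset ι) : Set ι) ⊆ ω').card ≤ 1} := by
    intro ω' hω'
    have hle : (R.filter fun x => ((T x : Finset ι) : Set ι) ⊆ ω').card ≤
        (R.filter fun x => x = o ∨ ∀ i, i ≤ depth x → par^[i] x ∈ ω').card := by
      apply Finset.card_le_card
      intro x hx
      rw [Finset.mem_filter] at hx ⊢
      exact ⟨hx.1, Or.inr fun i hi => hx.2 (Finset.mem_coe.2 ((tree_mem_anc depth par x _).2 ⟨i, hi, rfl⟩))⟩
    exact le_trans hle hω'
  exact le_trans (measureReal_mono hsub (measure_ne_top _ _)) h1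

/-! ### Route vocabulary -/

/-- The path product of `Quant.tree_real_openConn_eq_prod` is the gate product over the ancestral chain, for any gate
assignment `q` agreeing with the parent-pair weights off the root. [this work] -/
theorem tree_prod_anc_eq (w : Sym2 ι → unitInterval) (q : ι → unitInterval) (o : ι) (depth : ι → ℕ) (par : ι → ι)
    (hstep : ∀ x, x ≠ o → depth x ≠ 0 → par x ≠ o ∧ depth (par x) + 1 = depth x)
    (hq : ∀ x, x ≠ o → q x = w s(par x, x)) (a : ι) (hao : a ≠ o) :
    ∏ i ∈ (Finset.range (depth a + 1)).image (fun i => par^[i] a), (q i : ℝ) =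
      ∏ i ∈ Finset.range (depth a + 1), (w s(par (par^[i] a), par^[i] a) : ℝ) := by
  have hanc := chain_iterate_par o depth par hstep a hao
  have hinj : Set.InjOn (fun i => par^[i] a) ↑(Finset.range (depth a + 1)) := by
    intro i hi i' hi' h
    have hi1 : i ≤ depth a := by have := Finset.mem_range.1 (Finset.mem_coe.1 hi); omega
    have hi2 : i' ≤ depth a := by have := Finset.mem_range.1 (Finset.mem_coe.1 hi'); omega
    have e1 := (hanc i hi1).2
    have e2 := (hanc i' hi2).2
    have : depth (par^[i] a) = depth (par^[i'] a) := by
      show depth ((fun i => par^[i] a) i) = depth ((fun i => par^[i] a) i')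
      rw [h]
    omega
  rw [Finset.prod_image hinj]
  refine Finset.prod_congr rfl fun i hi => ?_
  rw [hq _ (hanc i (by have := Finset.mem_range.1 hi; omega)).1]

/-- **Layer one of FAR on every tree with two reliable companions (route vocabulary).**  Tree-supported weights `w` on the pairs of
`Fin n` (every nonzero-weight pair a loop or a parent pair), relay set `A`, three distinct non-root relays `a, b, c ∈ A` with
`P(o ↔ a) ≤ P(o ↔ b)`, `P(o ↔ a) ≤ P(o ↔ c)` and `1 ≤ P(o ↔ b) + P(o ↔ c)`.  Then `P(#{x ∈ A | o ↔ x} ≤ 1) ≤ P(o ↮ a)`: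
at most one relay is reached no more often than the weakest witness is missed.  No mean hypothesis. [this work] -/
theorem farRelayRow_tree_layerOne_of_companions (n : ℕ) (w : Sym2 (Fin n) → unitInterval) (o : Fin n) (depth : Fin n → ℕ)
    (par : Fin n → Fin n)
    (hroot : ∀ x, x ≠ o → depth x = 0 → par x = o)
    (hstep : ∀ x, x ≠ o → depth x ≠ 0 → par x ≠ o ∧ depth (par x) + 1 = depth x)
    (hsupp : ∀ e, w e ≠ 0 → e.IsDiag ∨ ∃ x, x ≠ o ∧ e = s(par x, x))
    (A : Finset (Fin n)) {a b c : Fin n} (haA : a ∈ A) (hbA : b ∈ A) (hcA : c ∈ A)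
    (hao : a ≠ o) (hbo : b ≠ o) (hco : c ≠ o) (hab : a ≠ b) (hac : a ≠ c) (hbc : b ≠ c)
    (hAB : (prodBernoulli w).real (openConn o a) ≤ (prodBernoulli w).real (openConn o b))
    (hAC : (prodBernoulli w).real (openConn o a) ≤ (prodBernoulli w).real (openConn o c))
    (hsum : 1 ≤ (prodBernoulli w).real (openConn o b) + (prodBernoulli w).real (openConn o c)) :
    (prodBernoulli w).real {ω : BondConfig (Fin n) | (A.filter fun x => ω ∈ openConn o x).card ≤ 1} ≤
      (prodBernoulli w).real (openConn o a : Set (BondConfig (Fin n)))ᶜ := by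
  have hmeasB : ∀ S : Set (BondConfig (Fin n)), MeasurableSet S := fun S => (Set.toFinite S).measurableSet
  set q : Fin n → unitInterval := fun x => if x = o then 1 else w s(par x, x) with hq
  have hq' : ∀ x, x ≠ o → q x = w s(par x, x) := fun x hx => by simp [hq, hx]
  rw [probReal_compl_eq_one_sub (hmeasB _), tree_relayCount_transfer n w o depth par hroot hstep hsupp A 1]
  rw [tree_real_openConn_eq_prod n w o depth par hroot hstep hsupp a hao, ← tree_prod_anc_eq w q o depth par hstep hq' a hao]
    at hAB hAC ⊢
  rw [tree_real_openConn_eq_prod n w o depth par hroot hstep hsupp b hbo, ← tree_prod_anc_eq w q o depth par hstep hq' b hbo]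
    at hAB hsum
  rw [tree_real_openConn_eq_prod n w o depth par hroot hstep hsupp c hco, ← tree_prod_anc_eq w q o depth par hstep hq' c hco]
    at hAC hsum
  have h := tree_gate_card_le_one_le o depth par hstep q A haA hbA hcA hao hbo hco hab hac hbc hAB hAC hsum
  -- the generic lemma carries the classical `DecidablePred` for the filter; `convert` bridges the instances
  convert h using 7

/-- **The `j = 1` instance of `Quant.FarRelayRow` on every tree, regime `t ≤ 1/2`** (= MAJORITY(3) on trees, FAR normalisation).
Tree-supported weights; `2 < Σ_{a∈A} P(o ↔ a)` and `P(o ↮ a) ≤ t ≤ 1/2` for every `a ∈ A` imply `P(#{a ∈ A | o ↔ a} ≤ 1) ≤ t`.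
Proof: `|A| ≥ 3`; if `o ∈ A` the event forces a second relay to be missed; else take `a` the least likely relay and any two
companions (marginals `≥ 1/2`, so they sum to `≥ 1`) in `farRelayRow_tree_layerOne_of_companions`.  On general graphs the same
statement without the mean hypothesis is false from five vertices (`Quant.majorityRow_false_layerOne`). [this work] -/
theorem farRelayRow_tree_layerOne_half (n : ℕ) (w : Sym2 (Fin n) → unitInterval) (o : Fin n) (depth : Fin n → ℕ)
    (par : Fin n → Fin n)
    (hroot : ∀ x, x ≠ o → depth x = 0 → par x = o)
    (hstep : ∀ x, x ≠ o → depth x ≠ 0 → par x ≠ o ∧ depth (par x) + 1 = depth x)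
    (hsupp : ∀ e, w e ≠ 0 → e.IsDiag ∨ ∃ x, x ≠ o ∧ e = s(par x, x))
    (A : Finset (Fin n)) (t : ℝ)
    (hEN : (2 : ℝ) < ∑ a ∈ A, (prodBernoulli w).real (openConn o a))
    (hcut : ∀ a ∈ A, (prodBernoulli w).real (openConn o a : Set (BondConfig (Fin n)))ᶜ ≤ t) (ht : t ≤ 1 / 2) :
    (prodBernoulli w).real {ω : BondConfig (Fin n) | (A.filter fun x => ω ∈ openConn o x).card ≤ 1} ≤ t := by
  set μ := prodBernoulli w with hμ
  have hmeasB : ∀ S : Set (BondConfig (Fin n)), MeasurableSet S := fun S => (Set.toFinite S).measurableSet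
  have hmarg : ∀ x, μ.real (openConn o x : Set (BondConfig (Fin n)))ᶜ = 1 - μ.real (openConn o x) := fun x =>
    probReal_compl_eq_one_sub (hmeasB _)
  -- `|A| ≥ 3`
  have hcard : 2 < A.card := by
    have h1 : ∑ a ∈ A, μ.real (openConn o a : Set (BondConfig (Fin n))) ≤ ∑ a ∈ A, (1 : ℝ) :=
      Finset.sum_le_sum fun a _ => measureReal_le_one
    rw [Finset.sum_const, nsmul_eq_mul, mul_one] at h1
    exact_mod_cast (lt_of_lt_of_le hEN h1)
  by_cases hoA : o ∈ A
  · -- pick `b ∈ A`, `b ≠ o`: `N ≤ 1` forces `o ↮ b` because `o ↔ o` always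
    have hcard' : 0 < (A.erase o).card := by rw [Finset.card_erase_of_mem hoA]; omega
    obtain ⟨b, hb⟩ := Finset.card_pos.1 hcard'
    have hbo : b ≠ o := (Finset.mem_erase.1 hb).1
    have hbA : b ∈ A := (Finset.mem_erase.1 hb).2
    have hsub : {ω : BondConfig (Fin n) | (A.filter fun x => ω ∈ openConn o x).card ≤ 1} ⊆
        (openConn o b : Set (BondConfig (Fin n)))ᶜ := by
      intro ω hω hωb
      have hω1 : (A.filter fun x => ω ∈ openConn o x).card ≤ 1 := hω
      have h2 : ({o, b} : Finset (Fin n)) ⊆ A.filter fun x => ω ∈ openConn o x := by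
        intro x hx
        rw [Finset.mem_insert, Finset.mem_singleton] at hx
        rw [Finset.mem_filter]
        rcases hx with rfl | rfl
        · exact ⟨hoA, SimpleGraph.Reachable.refl _⟩
        · exact ⟨hbA, hωb⟩
      have := Finset.card_le_card h2
      rw [Finset.card_pair hbo.symm] at this
      omega
    exact le_trans (measureReal_mono hsub (measure_ne_top _ _)) (hcut b hbA)
  · -- `o ∉ A`: the least likely relay and two companions
    have hne : A.Nonempty := Finset.card_pos.1 (by omega)
    obtain ⟨a, haA, hmin⟩ := Finset.exists_min_image A (fun x => μ.real (openConn o x : Set (BondConfig (Fin n)))) hne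
    have hao : a ≠ o := fun h => hoA (h ▸ haA)
    have hcard' : 1 < (A.erase a).card := by rw [Finset.card_erase_of_mem haA]; omega
    obtain ⟨b, hb, c, hc, hbc⟩ := Finset.one_lt_card.1 hcard'
    have hba : b ≠ a := (Finset.mem_erase.1 hb).1
    have hbA : b ∈ A := (Finset.mem_erase.1 hb).2
    have hca : c ≠ a := (Finset.mem_erase.1 hc).1
    have hcA : c ∈ A := (Finset.mem_erase.1 hc).2
    have hbo : b ≠ o := fun h => hoA (h ▸ hbA)
    have hco : c ≠ o := fun h => hoA (h ▸ hcA)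
    have hb2 : 1 / 2 ≤ μ.real (openConn o b : Set (BondConfig (Fin n))) := by
      have := hcut b hbA; rw [hmarg] at this; linarith
    have hc2 : 1 / 2 ≤ μ.real (openConn o c : Set (BondConfig (Fin n))) := by
      have := hcut c hcA; rw [hmarg] at this; linarith
    have h := farRelayRow_tree_layerOne_of_companions n w o depth par hroot hstep hsupp A haA hbA hcA hao hbo hco
      hba.symm hca.symm hbc (hmin b hbA) (hmin c hcA) (by linarith)
    exact le_trans h (hcut a haA)

end Quant

end Summit.CriticalPhenomena.PercolationContinuityZ3.Theorems

end
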